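import Literature.Geometry.Lorentzian.GerochMonotonicityProofs
import HarnessLib

/-!
# Geroch monotonicity: the integrability side conditions are automatic

`geroch_monotonicity_smooth_of_inputs₃` (`GerochMonotonicityProofs.lean`) reduces the named fact
`geroch_monotonicity_smooth` (Huisken–Ilmanen 2001, §5, Monotonicity Calculation, smooth case)
to, for each classical solution and time: (F1) the derivative of `∫ H²` with the evolution equation
(1.3), (F2) the Gauss equation, (F3) the Gauss–Bonnet bound, AND the integrability on the compact
leaf `N_t` of `H Δ(H⁻¹)`, `|A|²`, `R(h) ∘ F_t`, `R(g_t)`, `H²`. This file discharges the five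
integrability conditions: each integrand is a continuous function on the compact surface `S`
(finite area measure), by the regularity already in the tree —
`H ∈ C^∞` (`IsClassicalIMCF.contMDiff_meanCurvature`), `Δ_{g_t}` of a `C²` function is continuous
(`continuous_dalembertian`), the scalar curvature of a smooth metric is smooth
(`contMDiff_scalarCurvature`, for `h` and for `g_t = F_t^* h`) — and the one new regularity
statement

* `PseudoRiemannianMetric.contMDiff_normSq_secondFundamentalForm` — `y ↦ |A|²_{g}(y)` is `C^∞`
  for a smooth spacelike immersion with smooth normal field, from the basis formula
  `|T|² = g^{ji} g^{lk} T_{kj} T_{li}` (a private copy of the formula of `RicciNormSq.lean`) and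
  `contMDiffAt_secondFundamentalForm_apply`;

giving

* `geroch_monotonicity_smooth_of_F123` — **the fact follows from (F1), (F2), (F3) alone.**

## References

* G. Huisken, T. Ilmanen, *The inverse mean curvature flow and the Riemannian Penrose
  inequality*, J. Differential Geom. 59 (2001) 353–437: §5, Monotonicity Calculation.
* B. O'Neill, *Semi-Riemannian geometry*, Academic Press 1983, Ch. 3, pp. 60–61 (metric
  contraction), Ch. 4, Lemma 4.
-/

noncomputable section

open Bundle Set Manifold TopologicalSpace Filter MeasureTheory
open scoped ContDiff Topology ENNReal Manifold Real

namespace Literature.Geometry.Lorentzian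

namespace PseudoRiemannianMetric

/-! ### The metric square norm in a basis -/

section NormSqBasis

variable {B : Type*} [TopologicalSpace B] {EB : Type*} [NormedAddCommGroup EB] [NormedSpace ℝ EB]
  {HB : Type*} [TopologicalSpace HB] [ChartedSpace HB B] {IB : ModelWithCorners ℝ EB HB}
  {n' : ℕ∞ω}
  {F' : Type*} [NormedAddCommGroup F'] [NormedSpace ℝ F'] {V : B → Type*}
  [TopologicalSpace (TotalSpace F' V)] [∀ b, TopologicalSpace (V b)] [∀ b, AddCommGroup (V b)]
  [∀ b, Module ℝ (V b)] [FiberBundle F' V] [VectorBundle ℝ F' V] [FiniteDimensional ℝ F']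
  {ι : Type*} [Fintype ι] [DecidableEq ι]

/-- The matrix of `♯ ∘ S` in a basis `β`: `(♯ ∘ S)ⁱₖ = ∑ⱼ (G⁻¹)ⱼᵢ S(βₖ, βⱼ)` with `G` the Gram
matrix (`gram_inv_eq`; O'Neill 1983, Ch. 3, p. 60, raising an index).
[cite: ONeill1983, Ch. 3, p. 60] -/
private theorem toMatrix_sharp_comp_apply (g' : PseudoRiemannianMetric IB n' F' V) (b : B)
    (β : Module.Basis ι ℝ (V b)) (S : LinearMap.BilinForm ℝ (V b)) (i k : ι) :
    haveI := VectorBundle.finiteDimensional ℝ F' V b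
    LinearMap.toMatrix β β ((g'.sharp b).toLinearMap ∘ₗ S) i k =
      ∑ j, (Matrix.of fun i j ↦ g'.val b (β i) (β j))⁻¹ j i * S (β k) (β j) := by
  haveI := VectorBundle.finiteDimensional ℝ F' V b
  rw [gram_inv_eq]
  simp only [Matrix.transpose_apply, Matrix.of_apply]
  rw [LinearMap.toMatrix_apply, LinearMap.comp_apply]
  conv_lhs => rw [← β.sum_dual_apply_smul_coord (S (β k))]
  rw [map_sum, map_sum, Finsupp.finsetSum_apply]
  refine Finset.sum_congr rfl fun j _ ↦ ?_
  rw [map_smul, map_smul, Finsupp.smul_apply, smul_eq_mul, mul_comm]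
  rfl

/-- **The metric square norm in a basis**:
`|T|²_g = ∑ᵢₖ (∑ⱼ (G⁻¹)ⱼᵢ T(βₖ, βⱼ)) (∑ₗ (G⁻¹)ₗₖ T(βₗ, βᵢ))`
(`= g^{ji} g^{lk} T_{kj} T_{li} = T_{ij} T^{ij}`), `G` the Gram matrix of the basis `β` — the
tree's `g.normSq` is `tr ((♯ ∘ T) ∘ (♯ ∘ Tᵗ))`, expanded in the basis.
O'Neill 1983, Ch. 3, pp. 60–61 (metric contraction). A local copy, in the index placement used
below, of the formula of `RicciNormSq.lean` (not imported, to keep this file's imports small).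
[cite: ONeill1983, Ch. 3, pp. 60–61] -/
private theorem normSq_eq_sum_gram_inv_aux (g' : PseudoRiemannianMetric IB n' F' V) (b : B)
    (β : Module.Basis ι ℝ (V b)) (T : LinearMap.BilinForm ℝ (V b)) :
    g'.normSq b T = ∑ i, ∑ k,
      (∑ j, (Matrix.of fun i j ↦ g'.val b (β i) (β j))⁻¹ j i * T (β k) (β j)) *
        (∑ l, (Matrix.of fun i j ↦ g'.val b (β i) (β j))⁻¹ l k * T (β l) (β i)) := by
  haveI := VectorBundle.finiteDimensional ℝ F' V b
  rw [PseudoRiemannianMetric.normSq, LinearMap.trace_eq_matrix_trace ℝ β,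
    LinearMap.toMatrix_comp β β β, Matrix.trace]
  refine Finset.sum_congr rfl fun i _ ↦ ?_
  rw [Matrix.diag_apply, Matrix.mul_apply]
  refine Finset.sum_congr rfl fun k _ ↦ ?_
  rw [toMatrix_sharp_comp_apply, toMatrix_sharp_comp_apply]
  rfl

end NormSqBasis

/-! ### Smoothness of `|A|²` -/

section NormSqSFF

variable {E : Type*} [NormedAddCommGroup E] [NormedSpace ℝ E] {H : Type*} [TopologicalSpace H]
  {I : ModelWithCorners ℝ E H} {M : Type*} [TopologicalSpace M] [ChartedSpace H M]
  [IsManifold I ∞ M] [FiniteDimensional ℝ E]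
  {E' : Type*} [NormedAddCommGroup E'] [NormedSpace ℝ E'] {H' : Type*} [TopologicalSpace H']
  {I' : ModelWithCorners ℝ E' H'} {N : Type*} [TopologicalSpace N] [ChartedSpace H' N]
  [IsManifold I' ∞ N]
  (g : PseudoRiemannianMetric I ∞ E (TangentSpace I : M → Type _)) [g.HasLeviCivita]
  [FiniteDimensional ℝ E'] [I'.Boundaryless] [CompleteSpace E]

/-- **`|A|²` of a smooth immersed hypersurface is a smooth function.** For a smooth spacelike
immersion `f : N → M` (induced metric `f^* g`) with a field `ν` along it whose lift to `TM` is
smooth, `y ↦ |K_ν|²_{f^*g}(y)` is `C^∞`: in the frame of `TN` at `y₀` it is the polynomial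
`g^{ji} g^{lk} K_{kj} K_{li}` in the smooth inverse Gram entries
(`contMDiffOn_gram_localFrame_inv`) and the smooth components `K(sₖ, sⱼ)`
(`contMDiffAt_secondFundamentalForm_apply`). O'Neill 1983, Ch. 4, Lemma 4 (the shape tensor is
`𝔉`-bilinear, hence smooth on smooth fields) with Ch. 3, pp. 60–61.
[cite: ONeill1983, Ch. 4, Lemma 4] -/
theorem contMDiff_normSq_secondFundamentalForm {f : N → M}
    (hpb : contMDiff_pullbackBilin I M I' N ∞) (hfi : g.IsSpacelikeImmersion I' f)
    (ν : NormalField I f)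
    (hν : ContMDiff I' I.tangent ∞ (fun x ↦ (TotalSpace.mk' E (f x) (ν x) : TangentBundle I M))) :
    CMDiff ∞ (fun y ↦ (g.inducedMetric f hpb hfi).normSq y (g.secondFundamentalForm I' f ν y)) := by
  classical
  have hf : ContMDiff I' I ∞ f := hfi.contMDiff_self
  intro y₀
  set e' := trivializationAt E' (TangentSpace I' : N → Type _) y₀ with he'
  set b' := Module.finBasis ℝ E' with hb'
  have hy₀ : y₀ ∈ e'.baseSet := FiberBundle.mem_baseSet_trivializationAt' y₀
  have hformula : (fun y ↦ (g.inducedMetric f hpb hfi).normSq y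
      (g.secondFundamentalForm I' f ν y)) =ᶠ[𝓝 y₀] fun y ↦ ∑ i, ∑ k,
      (∑ j, (Matrix.of fun a c ↦ (g.inducedMetric f hpb hfi).val y (e'.localFrame b' a y)
          (e'.localFrame b' c y))⁻¹ j i *
        g.secondFundamentalForm I' f ν y (e'.localFrame b' k y) (e'.localFrame b' j y)) *
      (∑ l, (Matrix.of fun a c ↦ (g.inducedMetric f hpb hfi).val y (e'.localFrame b' a y)
          (e'.localFrame b' c y))⁻¹ l k *
        g.secondFundamentalForm I' f ν y (e'.localFrame b' l y) (e'.localFrame b' i y)) := by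
    filter_upwards [e'.open_baseSet.mem_nhds hy₀] with y hy
    rw [normSq_eq_sum_gram_inv_aux _ y (e'.basisAt b' hy)]
    simp only [← e'.localFrame_apply_of_mem_baseSet b' hy]
  refine ContMDiffAt.congr_of_eventuallyEq ?_ hformula
  have hG : ∀ a c, CMDiffAt ∞ (fun y ↦ (Matrix.of fun a c ↦ (g.inducedMetric f hpb hfi).val y
      (e'.localFrame b' a y) (e'.localFrame b' c y))⁻¹ a c) y₀ := fun a c ↦
    (contMDiffOn_gram_localFrame_inv e' (g.inducedMetric f hpb hfi) b' a c y₀ hy₀).contMDiffAt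
      (e'.open_baseSet.mem_nhds hy₀)
  have hK : ∀ a c, CMDiffAt ∞ (fun y ↦ g.secondFundamentalForm I' f ν y (e'.localFrame b' a y)
      (e'.localFrame b' c y)) y₀ := fun a c ↦
    g.contMDiffAt_secondFundamentalForm_apply hf hν (contMDiffAt_localFrame_of_mem ∞ e' b' a hy₀)
      (contMDiffAt_localFrame_of_mem ∞ e' b' c hy₀)
  refine ContMDiffAt.sum fun i _ ↦ ContMDiffAt.sum fun k _ ↦ ?_
  exact (ContMDiffAt.sum fun j _ ↦ (hG j i).mul (hK k j)).mul
    (ContMDiffAt.sum fun l _ ↦ (hG l k).mul (hK l i))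

end NormSqSFF

end PseudoRiemannianMetric

/-! ### The fact from (F1)–(F3) -/

section Inputs

open PseudoRiemannianMetric

variable {X : Type} [TopologicalSpace X] [ChartedSpace E3 X] [IsManifold (𝓡 3) ∞ X]
  {h : ContMDiffRiemannianMetric (𝓡 3) ∞ E3 (TangentSpace (𝓡 3) : X → Type _)}
  [(ofRiemannian h).HasLeviCivita]
  {S : Type} [TopologicalSpace S] [ChartedSpace (EuclideanSpace ℝ (Fin 2)) S]
  [IsManifold (𝓡 2) ∞ S] {hpb : contMDiff_pullbackBilin (𝓡 3) X (𝓡 2) S ∞}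
  {F : ℝ → S → X} {ν : (t : ℝ) → NormalField (𝓡 3) (F t)} {a b : ℝ}
  [CompactSpace S] [T2Space S] [MeasurableSpace S] [BorelSpace S]

omit [CompactSpace S] [T2Space S] [MeasurableSpace S] [BorelSpace S] in
/-- **The five integrands of the Monotonicity Calculation are continuous on the leaf**: for a
classical solution and `t ∈ (a, b)`, the functions `H Δ_{g_t}(H⁻¹)`, `|A|²_{g_t}`, `R(h) ∘ F_t`,
`R(g_t)` and `H²` on `S` are continuous (`H ∈ C^∞`, `H > 0`, `continuous_dalembertian`,
`contMDiff_normSq_secondFundamentalForm`, `contMDiff_scalarCurvature`).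
[cite: HuiskenIlmanenIMCF2001, §5 Monotonicity Calculation (smooth case)] -/
theorem IsClassicalIMCF.continuous_integrands (Hc : IsClassicalIMCF h hpb F ν a b) {t : ℝ}
    (ht : t ∈ Set.Ioo a b) :
    haveI := ((ofRiemannian h).inducedMetric (F t) hpb (Hc.isSpacelikeImmersion t ht)).hasLeviCivita
    Continuous (fun y ↦ (ofRiemannian h).meanCurvature (F t) hpb
        (Hc.isSpacelikeImmersion t ht) (ν t) y *
      ((ofRiemannian h).inducedMetric (F t) hpb (Hc.isSpacelikeImmersion t ht)).dalembertian
        (fun z ↦ ((ofRiemannian h).meanCurvature (F t) hpb (Hc.isSpacelikeImmersion t ht)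
          (ν t) z)⁻¹) y) ∧
    Continuous (fun y ↦
      ((ofRiemannian h).inducedMetric (F t) hpb (Hc.isSpacelikeImmersion t ht)).normSq y
        ((ofRiemannian h).secondFundamentalForm (𝓡 2) (F t) (ν t) y)) ∧
    Continuous (fun y ↦ (ofRiemannian h).scalarCurvature (F t y)) ∧
    Continuous (fun y ↦
      ((ofRiemannian h).inducedMetric (F t) hpb (Hc.isSpacelikeImmersion t ht)).scalarCurvature y) ∧
    Continuous (fun y ↦
      (ofRiemannian h).meanCurvature (F t) hpb (Hc.isSpacelikeImmersion t ht) (ν t) y ^ 2) := by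
  haveI := ((ofRiemannian h).inducedMetric (F t) hpb (Hc.isSpacelikeImmersion t ht)).hasLeviCivita
  have hH := Hc.contMDiff_meanCurvature ht
  have hHc : Continuous fun y ↦ (ofRiemannian h).meanCurvature (F t) hpb
      (Hc.isSpacelikeImmersion t ht) (ν t) y := hH.continuous
  have hne : ∀ y, (ofRiemannian h).meanCurvature (F t) hpb (Hc.isSpacelikeImmersion t ht) (ν t) y
      ≠ 0 := fun y ↦ (Hc.meanCurvature_pos t ht y).ne'
  have hinv : ContMDiff (𝓡 2) 𝓘(ℝ, ℝ) 2 (fun z ↦ ((ofRiemannian h).meanCurvature (F t) hpb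
      (Hc.isSpacelikeImmersion t ht) (ν t) z)⁻¹) :=
    (hH.inv₀ hne).of_le (by exact WithTop.coe_le_coe.2 le_top)
  refine ⟨hHc.mul (continuous_dalembertian _ hinv), ?_, ?_, ?_, hHc.pow 2⟩
  · exact ((ofRiemannian h).contMDiff_normSq_secondFundamentalForm hpb
      (Hc.isSpacelikeImmersion t ht) (ν t) (Hc.contMDiff_normal t ht)).continuous
  · exact (ofRiemannian h).contMDiff_scalarCurvature.continuous.comp
      ((Hc.isSpacelikeImmersion t ht).contMDiff_self.continuous)
  · exact ((ofRiemannian h).inducedMetric (F t) hpb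
      (Hc.isSpacelikeImmersion t ht)).contMDiff_scalarCurvature.continuous

/-- A continuous function on the compact leaf is integrable for the area measure `dμ_t`
(finite total area, `isFiniteMeasure_riemannianMeasure`). [folklore] -/
theorem IsClassicalIMCF.integrable_of_continuous (Hc : IsClassicalIMCF h hpb F ν a b) {t : ℝ}
    (ht : t ∈ Set.Ioo a b) {φ : S → ℝ} (hφ : Continuous φ) :
    Integrable φ (riemannianVolume ((ofRiemannian h).inducedRiemannianMetric (F t) hpb
      (Hc.isSpacelikeImmersion t ht)) 2) := by
  have key := Lorentzian.integrable_of_continuous (I := 𝓡 2)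
    ((ofRiemannian h).inducedRiemannianMetric (F t) hpb (Hc.isSpacelikeImmersion t ht)) hφ
  rw [riemannianMeasure_eq_riemannianVolume] at key
  exact key

/-- **`geroch_monotonicity_smooth` from (F1)–(F3).** The named fact (Huisken–Ilmanen 2001, §5,
Monotonicity Calculation, smooth case) follows from the three remaining classical inputs at each
time of each classical solution with `R ≥ 0`: (F1) the derivative
`d/dt ∫ H² = ∫ (2H ∂_tH + H²) dμ_t` with the evolution equation (1.3) for `∂_t H`, (F2) the Gauss
equation `R(g_t) = R(h)∘F_t − 2Rc(ν,ν) + H² − |A|²`, (F3) the Gauss–Bonnet bound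
`∫ R(g_t) dμ_t ≤ 8π` — `geroch_monotonicity_smooth_of_inputs₃` with the integrability conditions
discharged by continuity on the compact leaf (`IsClassicalIMCF.continuous_integrands`).
[cite: HuiskenIlmanenIMCF2001, §5 Monotonicity Calculation (smooth case)] -/
theorem geroch_monotonicity_smooth_of_F123
    (hin : ∀ (X : Type) [TopologicalSpace X] [ChartedSpace E3 X] [IsManifold (𝓡 3) ∞ X]
      [T2Space X] [SecondCountableTopology X]
      (h : ContMDiffRiemannianMetric (𝓡 3) ∞ E3 (TangentSpace (𝓡 3) : X → Type _))
      [(ofRiemannian h).HasLeviCivita]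
      (S : Type) [TopologicalSpace S] [ChartedSpace (EuclideanSpace ℝ (Fin 2)) S]
      [IsManifold (𝓡 2) ∞ S] [CompactSpace S] [T2Space S] [ConnectedSpace S]
      [MeasurableSpace S] [BorelSpace S]
      (hpb : contMDiff_pullbackBilin (𝓡 3) X (𝓡 2) S ∞)
      (F : ℝ → S → X) (ν : (t : ℝ) → NormalField (𝓡 3) (F t)) (a b : ℝ)
      (Hc : IsClassicalIMCF h hpb F ν a b),
      (∀ x : X, 0 ≤ (ofRiemannian h).scalarCurvature x) →
      ∀ t (ht : t ∈ Set.Ioo a b),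
      haveI := ((ofRiemannian h).inducedMetric (F t) hpb
        (Hc.isSpacelikeImmersion t ht)).hasLeviCivita
      ∃ dH : S → ℝ,
        HasDerivAt Hc.sqMeanCurvatureIntegral
          (∫ y, (2 * (ofRiemannian h).meanCurvature (F t) hpb (Hc.isSpacelikeImmersion t ht) (ν t)
              y * dH y +
            (ofRiemannian h).meanCurvature (F t) hpb (Hc.isSpacelikeImmersion t ht) (ν t) y ^ 2)
            ∂(riemannianVolume ((ofRiemannian h).inducedRiemannianMetric (F t) hpb
              (Hc.isSpacelikeImmersion t ht)) 2)) t ∧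
        (∀ y, dH y =
          -((ofRiemannian h).inducedMetric (F t) hpb (Hc.isSpacelikeImmersion t ht)).dalembertian
              (fun z ↦ ((ofRiemannian h).meanCurvature (F t) hpb (Hc.isSpacelikeImmersion t ht)
                (ν t) z)⁻¹) y -
            (((ofRiemannian h).inducedMetric (F t) hpb (Hc.isSpacelikeImmersion t ht)).normSq y
                ((ofRiemannian h).secondFundamentalForm (𝓡 2) (F t) (ν t) y) +
              (ofRiemannian h).ricci (F t y) (ν t y) (ν t y)) /
            (ofRiemannian h).meanCurvature (F t) hpb (Hc.isSpacelikeImmersion t ht) (ν t) y) ∧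
        (∀ y, ((ofRiemannian h).inducedMetric (F t) hpb
            (Hc.isSpacelikeImmersion t ht)).scalarCurvature y =
          (ofRiemannian h).scalarCurvature (F t y) -
            2 * (ofRiemannian h).ricci (F t y) (ν t y) (ν t y) +
            (ofRiemannian h).meanCurvature (F t) hpb (Hc.isSpacelikeImmersion t ht) (ν t) y ^ 2 -
            ((ofRiemannian h).inducedMetric (F t) hpb (Hc.isSpacelikeImmersion t ht)).normSq y
              ((ofRiemannian h).secondFundamentalForm (𝓡 2) (F t) (ν t) y)) ∧
        (∫ y, ((ofRiemannian h).inducedMetric (F t) hpb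
            (Hc.isSpacelikeImmersion t ht)).scalarCurvature y
          ∂(riemannianVolume ((ofRiemannian h).inducedRiemannianMetric (F t) hpb
            (Hc.isSpacelikeImmersion t ht)) 2) ≤ 8 * π)) :
    geroch_monotonicity_smooth := by
  refine geroch_monotonicity_smooth_of_inputs₃ ?_
  intro X _ _ _ _ _ h _ S _ _ _ _ _ _ _ _ hpb F ν a b Hc hR t ht
  obtain ⟨dH, hD, hevol, hGauss, hGB⟩ := hin X h S hpb F ν a b Hc hR t ht
  obtain ⟨c1, c2, c3, c4, c5⟩ := Hc.continuous_integrands ht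
  exact ⟨dH, hD, hevol, hGauss, hGB, Hc.integrable_of_continuous ht c1,
    Hc.integrable_of_continuous ht c2, Hc.integrable_of_continuous ht c3,
    Hc.integrable_of_continuous ht c4, Hc.integrable_of_continuous ht c5⟩

end Inputs

end Literature.Geometry.Lorentzian

end
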